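import Summits.QuantumFields.BalabanUV.Beta.GAN24.HalfMemberCellOfDivergences
import Summits.QuantumFields.BalabanUV.Beta.GAN24.TableDressingExpansion
import Summits.QuantumFields.BalabanUV.Beta.GAN24.T2DevConservationDefectRows

/-!
# `BalabanUV.Beta.GAN24.HalfMemberCellDriftOfDivergences` — binder row G-an2-4 ∕ (CONV-C), W-slot, the (α-0) parity re-cut's (α-END-b′): **THE CELLS' ONE-STEP DRIFT
# `hcelld` FROM THE FOUR LETTER ROWS AND THE FOUR LETTER-DRIFT ROWS** — the OWNER gan24-p1 g34's ASK A-g34-1 (journal l.50858, his INTENT-ANNOUNCE 2 `T2DriftEvenEndRows`'s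
# ONE new displayed row `hcelld : ∀ l, LocStencil₂ (cell^{ε}_{l+1} − cell^{ε}_l) (Ccd·θc^l) δcd`), journal INTENT [LEAF03-G66-PROPOSED1] (c) «DIVERGENCE LETTER DRIFTS ⇒ CELL DRIFT».

NOT IN PRINT; OUR BOOKKEEPING (G-an2-4 crux team (2), leaf prover `b2b-balaban-gan24-formalise-leaf-03`, gen 66).  [folklore] composition BY NAME — leaf-01 g63's
`T2DevConservationDefectRows.exists_hHr_of_defect_rows` pattern at the `ε`-member: `𝔇` is LEVEL-FREE, so with `D_l := 𝔇 Z_l − Z_l` the cell is `cell_l = 𝒜^K_l D_l` (leaf-06's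
`lin4_comb_coDressKBmAt_sub`), `cell_{l+1} − cell_l = (𝒜^K_{l+1} − 𝒜^K_l) D_{l+1} + 𝒜^K_l (D_{l+1} − D_l)` (leaf-01's `lin4_sub`), `D_{l+1} − D_l = 𝔇 (Z_{l+1} − Z_l) − (Z_{l+1} − Z_l)`
(leaf-06's `tableDress_sub`); term one is MY `TransportStepLipschitz.lin_cauchy` (the K-slot's CAUCHY row) on `D_{l+1}` (FILE 1's uniform shape), term two leaf-01's `exists_lin4_rate`
on the defect of the DIFFERENCE (FILE 1 on `Z_{l+1} − Z_l`).  0 `def`, 0 cited facts, 0 `def … : Prop`, 0 sorry.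
HONEST FRAMING (cell contract, verbatim): «discharging `BetaPertH` makes Bałaban's UV stability UNCONDITIONAL — a real constructive-QFT result; it is NOT the continuum
limit and NOT the Clay problem.»  HONEST DEPENDENCY (verbatim): «continuum YM on T⁴ ⇐ BetaPertH ∧ nine spine estimates (0/9 proved); BetaPertH ⇐ (D1) ∧ (D4) ∧ CAP+tail;
G-an2-4 gates asym, D1 and NE2/3/4.»
* §1 `divRow_snd ∕ fst ∕ leg₁ ∕ leg₂_sub` (the four letter tables are LINEAR), `locStencil₂_tableDress_defect_sub_of_divergences` (the four rows of `Y − Y′` ⟹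
  `LocStencil₂ ((𝔇 Y − Y) − (𝔇 Y′ − Y′)) C_𝔇 δ`, FILE 1's constant).
* §2 `cellDrift_rows_of_divergence_rows` (generic `d`, any family `Z`, DISPLAYED `hK` ∕ `hKc` in road P1's `UnitDecayK ∕ CauchyDecayK` shapes): the four letter rows on `Z_l`
  (`l`-free) ∧ the four letter rows on `Z_{l+1} − Z_l` (constants `C′_s·θ^l`) ⟹ `∃ Ccd θc δcd, … ∧ ∀ l, LocStencil₂ (cell_{l+1} − cell_l) (Ccd·θc^l) δcd` (`θc = max θK θ`).
* §3 `hcelld_of_divergence_rows` (`d = 3`, `2 ≤ Lc`; K-slot `convCKWall_holds`, member shapes BY NAME): the OWNER gan24-p1 g34's row (α-END-b′) `hcelld` at the `ε`-member, in the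
  `hcell` spelling of shape PART 2.
WHAT STAYS DISPLAYED for «T2Drift^{ε}»: the four letter rows (as for «T2Shape^{ε}», FILE 3a) AND the four letter-DRIFT rows — slot ones ⟸ (b1) differenced + F4b + row (ii)'s
drift (p2 ∕ leaf-01), LEG ones = (Q-L)'s RATE half (row L11, OPEN) — plus the OWNER's `hbd` and `hC`.  Asserts NO value of any divergence of Bałaban's tables; discharges NOTHING
of (Q-L) ∕ (Q-S) ∕ (C) ∕ «T2Shape» ∕ «T2Drift» ∕ (hW, hWall); (β) untouched; 0 wall binders; NEVER «G-an2-4 closed» as (CONV-C); NOT D1, NOT `BetaPertH`, NOT continuum, NOT Clay;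
not in print — our bookkeeping.  Unit `b2b-balaban-gan24-formalise-leaf-03` (gen 66), 2026-08-23.
-/

noncomputable section

open Finset
open scoped BigOperators
open Literature.MathematicalPhysics.QuantumFieldTheory
open Literature.MathematicalPhysics.QuantumFieldTheory.Balaban1983to89
open Literature.MathematicalPhysics.QuantumFieldTheory.Balaban1983to89.Beta
open ExpKernelCalculus (MKer shiftK BiLoc Decays Zl)
open OneStepResolventKernel (Fib LocStencil decays_mono)
open OneStepKernelFamily (KInvStep)
open AffineAveraging (box toSite unitVec)
open AveragingMixedJetTables (mixFFAt)
open SecondOrderResponse (W2SymOfK cBi)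
open KernelWard (divV)
open BalabanCompositeJets (LocStencil₂)
open BalabanStepJetsSucc (mmRead)
open BalabanStepW2 (K3OfK M2Of)
open Summit.QuantumFields.BalabanUV.Beta.TameKernelCalculus (trK)
open Summit.QuantumFields.BalabanUV.Beta.BorderedHessian (sgnK)
open Summit.QuantumFields.BalabanUV.Beta.HessKerDressedUnits (unitK unitS)
open Summit.QuantumFields.BalabanUV.Beta.SecondOrderUnits (unitM unitS₂ unitM₂)
open Summit.QuantumFields.BalabanUV.Beta.AxialDressingRooted (cWb cKb coDressKBmAt coProjBmAtK dressKBmAt one_le_of_neZero)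
open Summit.QuantumFields.BalabanUV.Beta.SpineRooted (T2RecAt SpureRecAt M1At)
open Summit.QuantumFields.BalabanUV.Beta.GAN24.CombesThomas (sfStep smStep)
open Summit.QuantumFields.BalabanUV.Beta.GAN24.T2RecursionAffine (lin4)
open Summit.QuantumFields.BalabanUV.Beta.GAN24.BiStencilZeroMode (Tab)
open Summit.QuantumFields.BalabanUV.Beta.GAN24.KSlotAssembly (convCKWall_holds)
open Summit.QuantumFields.BalabanUV.Beta.GAN24.Lin4Additive (lin4_sub)
open Summit.QuantumFields.BalabanUV.Beta.GAN24.TableDressingDefect (lin4_comb_coDressKBmAt_sub)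
open Summit.QuantumFields.BalabanUV.Beta.GAN24.TableDressingExpansion (tableDress_sub)
open Summit.QuantumFields.BalabanUV.Beta.GAN24.T2RecChargeStep (shape_member)
open Summit.QuantumFields.BalabanUV.Beta.GAN24.T2ShapeEvenEnd (locStencil₂_halfTable)
open Summit.QuantumFields.BalabanUV.Beta.GAN24.WSlotT2OfPieces (sup_of_locStencil₂)
open Summit.QuantumFields.BalabanUV.Beta.GAN24.WSlotCauchyOfShapes (locStencil₂_le_mono)
open Summit.QuantumFields.BalabanUV.Beta.GAN24.SecondOrderLipschitz (lSand)
open Summit.QuantumFields.BalabanUV.Beta.GAN24.SecondOrderLipschitzBi (lBi)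
open Summit.QuantumFields.BalabanUV.Beta.GAN24.TransportStepLipschitz (lin_cauchy)
open Summit.QuantumFields.BalabanUV.Beta.GAN24.T2DevConservationDefectRows (exists_lin4_rate locStencil₂_add_rate)
open Summit.QuantumFields.BalabanUV.Beta.GAN24.DressingDefectOfDivergences (locStencil₂_tableDress_sub_self_of_divergences defectConst_nonneg)

namespace Summit.QuantumFields.BalabanUV.Beta.GAN24.HalfMemberCellDriftOfDivergences

variable {d : ℕ}

/-! ## §1 The letters are linear; the defect of a difference -/

section Linear

/-- [folklore] `Λ₂ (Y − Y′) = Λ₂ Y − Λ₂ Y′`. -/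
theorem divRow_snd_sub (Y Y' : Tab d) :
    (fun (κ : Fin (d + 1)) (u : Fin (d + 1) → ℤ) (_ : Fin (d + 1)) (p : Fin (d + 1) → ℤ) => divV (fun κ₁ u₁ => (Y - Y') κ u κ₁ u₁) p)
      = (fun (κ : Fin (d + 1)) (u : Fin (d + 1) → ℤ) (_ : Fin (d + 1)) (p : Fin (d + 1) → ℤ) => divV (fun κ₁ u₁ => Y κ u κ₁ u₁) p)
        - (fun (κ : Fin (d + 1)) (u : Fin (d + 1) → ℤ) (_ : Fin (d + 1)) (p : Fin (d + 1) → ℤ) => divV (fun κ₁ u₁ => Y' κ u κ₁ u₁) p) := by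
  funext κ u ι p x z a b; simp only [KernelWard.divV, Finset.sum_apply, Pi.sub_apply, Finset.sum_sub_distrib]; ring

/-- [folklore] `Λ₁ (Y − Y′) = Λ₁ Y − Λ₁ Y′`. -/
theorem divRow_fst_sub (Y Y' : Tab d) :
    (fun (_ : Fin (d + 1)) (p : Fin (d + 1) → ℤ) (κ' : Fin (d + 1)) (u' : Fin (d + 1) → ℤ) => divV (fun κ₁ u₁ => (Y - Y') κ₁ u₁ κ' u') p)
      = (fun (_ : Fin (d + 1)) (p : Fin (d + 1) → ℤ) (κ' : Fin (d + 1)) (u' : Fin (d + 1) → ℤ) => divV (fun κ₁ u₁ => Y κ₁ u₁ κ' u') p)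
        - (fun (_ : Fin (d + 1)) (p : Fin (d + 1) → ℤ) (κ' : Fin (d + 1)) (u' : Fin (d + 1) → ℤ) => divV (fun κ₁ u₁ => Y' κ₁ u₁ κ' u') p) := by
  funext ι p κ' u' x z a b; simp only [KernelWard.divV, Finset.sum_apply, Pi.sub_apply, Finset.sum_sub_distrib]; ring

/-- [folklore] `Λ_{L1} (Y − Y′) = Λ_{L1} Y − Λ_{L1} Y′`. -/
theorem divRow_leg₁_sub (Y Y' : Tab d) :
    (fun κ u κ' u' => fun (p z : Fin (d + 1) → ℤ) (_ : Fib d) (b : Fib d) =>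
        ∑ β : Fin (d + 1), ((Y - Y') κ u κ' u' p z (Sum.inl β) b - (Y - Y') κ u κ' u' (p - unitVec β) z (Sum.inl β) b))
      = (fun κ u κ' u' => fun (p z : Fin (d + 1) → ℤ) (_ : Fib d) (b : Fib d) =>
          ∑ β : Fin (d + 1), (Y κ u κ' u' p z (Sum.inl β) b - Y κ u κ' u' (p - unitVec β) z (Sum.inl β) b))
        - (fun κ u κ' u' => fun (p z : Fin (d + 1) → ℤ) (_ : Fib d) (b : Fib d) =>
          ∑ β : Fin (d + 1), (Y' κ u κ' u' p z (Sum.inl β) b - Y' κ u κ' u' (p - unitVec β) z (Sum.inl β) b)) := by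
  funext κ u κ' u' p z a b; simp only [Pi.sub_apply, ← Finset.sum_sub_distrib]; exact Finset.sum_congr rfl fun β _ => by ring

/-- [folklore] `Λ_{L2} (Y − Y′) = Λ_{L2} Y − Λ_{L2} Y′`. -/
theorem divRow_leg₂_sub (Y Y' : Tab d) :
    (fun κ u κ' u' => fun (x p : Fin (d + 1) → ℤ) (a : Fib d) (_ : Fib d) =>
        ∑ β : Fin (d + 1), ((Y - Y') κ u κ' u' x p a (Sum.inl β) - (Y - Y') κ u κ' u' x (p - unitVec β) a (Sum.inl β)))
      = (fun κ u κ' u' => fun (x p : Fin (d + 1) → ℤ) (a : Fib d) (_ : Fib d) =>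
          ∑ β : Fin (d + 1), (Y κ u κ' u' x p a (Sum.inl β) - Y κ u κ' u' x (p - unitVec β) a (Sum.inl β)))
        - (fun κ u κ' u' => fun (x p : Fin (d + 1) → ℤ) (a : Fib d) (_ : Fib d) =>
          ∑ β : Fin (d + 1), (Y' κ u κ' u' x p a (Sum.inl β) - Y' κ u κ' u' x (p - unitVec β) a (Sum.inl β))) := by
  funext κ u κ' u' x p a b; simp only [Pi.sub_apply, ← Finset.sum_sub_distrib]; exact Finset.sum_congr rfl fun β _ => by ring

variable {N : ℕ} {r : Fin (d + 1) → ℕ}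

/-- NOT IN PRINT; OUR BOOKKEEPING.  **THE DEFECT OF A DIFFERENCE**: since `𝔇` is additive (leaf-06's `tableDress_sub`), `(𝔇 Y − Y) − (𝔇 Y′ − Y′) = 𝔇 (Y − Y′) − (Y − Y′)`, so the four
letter rows of the DIFFERENCE table `Y − Y′` bound it with FILE 1's level-free constant. -/
theorem locStencil₂_tableDress_defect_sub_of_divergences (hN : 1 ≤ N) (hr : r ∈ box (d + 1) N) (Y Y' : Tab d) {C₂ C₁ CL₁ CL₂ δ : ℝ} (hδ : 0 ≤ δ)
    (h₂ : LocStencil₂ (fun (κ : Fin (d + 1)) (u : Fin (d + 1) → ℤ) (_ : Fin (d + 1)) (p : Fin (d + 1) → ℤ) =>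
      divV (fun κ₁ u₁ => (Y - Y') κ u κ₁ u₁) p) C₂ δ)
    (h₁ : LocStencil₂ (fun (_ : Fin (d + 1)) (p : Fin (d + 1) → ℤ) (κ' : Fin (d + 1)) (u' : Fin (d + 1) → ℤ) =>
      divV (fun κ₁ u₁ => (Y - Y') κ₁ u₁ κ' u') p) C₁ δ)
    (hL₁ : LocStencil₂ (fun κ u κ' u' => fun (p z : Fin (d + 1) → ℤ) (_ : Fib d) (b : Fib d) =>
      ∑ β : Fin (d + 1), ((Y - Y') κ u κ' u' p z (Sum.inl β) b - (Y - Y') κ u κ' u' (p - unitVec β) z (Sum.inl β) b)) CL₁ δ)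
    (hL₂ : LocStencil₂ (fun κ u κ' u' => fun (x p : Fin (d + 1) → ℤ) (a : Fib d) (_ : Fib d) =>
      ∑ β : Fin (d + 1), ((Y - Y') κ u κ' u' x p a (Sum.inl β) - (Y - Y') κ u κ' u' x (p - unitVec β) a (Sum.inl β))) CL₂ δ) :
    LocStencil₂ (((fun κ u κ' u' => dressKBmAt (toSite r) N (coProjBmAtK (toSite r) N (fun κ₁ u₁ => coProjBmAtK (toSite r) N (Y κ₁ u₁) κ' u') κ u)) - Y)
        - ((fun κ u κ' u' => dressKBmAt (toSite r) N (coProjBmAtK (toSite r) N (fun κ₁ u₁ => coProjBmAtK (toSite r) N (Y' κ₁ u₁) κ' u') κ u)) - Y'))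
      (2 * ((d : ℝ) + 1) * N * ((((2 * N + 1) ^ (d + 1) : ℕ) : ℝ) * (Real.exp (δ * (((d : ℝ) + 1) * N)) * C₂))
        + 2 * ((d : ℝ) + 1) * N * ((((2 * N + 1) ^ (d + 1) : ℕ) : ℝ) * (Real.exp (3 * δ * (((d : ℝ) + 1) * N)) * (cKb d N δ * C₁)))
        + 2 * ((d : ℝ) + 1) * N * ((((2 * N + 1) ^ (d + 1) : ℕ) : ℝ)
            * (Real.exp (δ * (((d : ℝ) + 1) * N)) * (cWb d N * Real.exp (3 * δ * (((d : ℝ) + 1) * N)) * (cKb d N δ * CL₁))))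
        + 2 * ((d : ℝ) + 1) * N * ((((2 * N + 1) ^ (d + 1) : ℕ) : ℝ)
            * (Real.exp (δ * (((d : ℝ) + 1) * N)) * (cKb d N δ * (cWb d N * Real.exp (3 * δ * (((d : ℝ) + 1) * N)) * (cKb d N δ * CL₂))))))
      δ := by
  have e : ((fun κ u κ' u' => dressKBmAt (toSite r) N (coProjBmAtK (toSite r) N (fun κ₁ u₁ => coProjBmAtK (toSite r) N (Y κ₁ u₁) κ' u') κ u)) - Y)
        - ((fun κ u κ' u' => dressKBmAt (toSite r) N (coProjBmAtK (toSite r) N (fun κ₁ u₁ => coProjBmAtK (toSite r) N (Y' κ₁ u₁) κ' u') κ u)) - Y')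
      = (fun κ u κ' u' => dressKBmAt (toSite r) N (coProjBmAtK (toSite r) N (fun κ₁ u₁ => coProjBmAtK (toSite r) N ((Y - Y') κ₁ u₁) κ' u') κ u)) - (Y - Y') := by
    rw [tableDress_sub]
    abel
  rw [e]
  exact locStencil₂_tableDress_sub_self_of_divergences hN hr (Y - Y') hδ h₂ h₁ hL₁ hL₂

end Linear

/-! ## §2 Generic `d`: the cells' one-step drift from the letter rows and the letter-drift rows -/

section Generic

variable {Lc : ℕ} [NeZero Lc] {r : Fin (d + 1) → ℕ}

/-- [folklore] FILE 1's defect constant is LINEAR in the four letter constants (so rows at rate `C′·θ^l` give a defect at rate `C_𝔇(C′)·θ^l`). -/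
theorem defectConst_mul (d N : ℕ) (δ C₂ C₁ CL₁ CL₂ t : ℝ) :
    2 * ((d : ℝ) + 1) * N * ((((2 * N + 1) ^ (d + 1) : ℕ) : ℝ) * (Real.exp (δ * (((d : ℝ) + 1) * N)) * (C₂ * t)))
        + 2 * ((d : ℝ) + 1) * N * ((((2 * N + 1) ^ (d + 1) : ℕ) : ℝ) * (Real.exp (3 * δ * (((d : ℝ) + 1) * N)) * (cKb d N δ * (C₁ * t))))
        + 2 * ((d : ℝ) + 1) * N * ((((2 * N + 1) ^ (d + 1) : ℕ) : ℝ)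
            * (Real.exp (δ * (((d : ℝ) + 1) * N)) * (cWb d N * Real.exp (3 * δ * (((d : ℝ) + 1) * N)) * (cKb d N δ * (CL₁ * t)))))
        + 2 * ((d : ℝ) + 1) * N * ((((2 * N + 1) ^ (d + 1) : ℕ) : ℝ)
            * (Real.exp (δ * (((d : ℝ) + 1) * N)) * (cKb d N δ * (cWb d N * Real.exp (3 * δ * (((d : ℝ) + 1) * N)) * (cKb d N δ * (CL₂ * t))))))
      = (2 * ((d : ℝ) + 1) * N * ((((2 * N + 1) ^ (d + 1) : ℕ) : ℝ) * (Real.exp (δ * (((d : ℝ) + 1) * N)) * C₂))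
        + 2 * ((d : ℝ) + 1) * N * ((((2 * N + 1) ^ (d + 1) : ℕ) : ℝ) * (Real.exp (3 * δ * (((d : ℝ) + 1) * N)) * (cKb d N δ * C₁)))
        + 2 * ((d : ℝ) + 1) * N * ((((2 * N + 1) ^ (d + 1) : ℕ) : ℝ)
            * (Real.exp (δ * (((d : ℝ) + 1) * N)) * (cWb d N * Real.exp (3 * δ * (((d : ℝ) + 1) * N)) * (cKb d N δ * CL₁))))
        + 2 * ((d : ℝ) + 1) * N * ((((2 * N + 1) ^ (d + 1) : ℕ) : ℝ)
            * (Real.exp (δ * (((d : ℝ) + 1) * N)) * (cKb d N δ * (cWb d N * Real.exp (3 * δ * (((d : ℝ) + 1) * N)) * (cKb d N δ * CL₂)))))) * t := by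
  ring

/-- NOT IN PRINT; OUR BOOKKEEPING.  **THE CELLS' ONE-STEP DRIFT FROM THE FOUR LETTER ROWS AND THE FOUR LETTER-DRIFT ROWS** (generic `d`, in-block root, any `c`, ANY family
`Z : ℕ → Tab d` with SOME `LocStencil₂` shape each): under the unit step kernels' UNIFORM decay `hK` and CAUCHY row `hKc` (road P1's `UnitDecayK ∕ CauchyDecayK` shapes, DISPLAYED),
the four letter rows on `Z_l` (`l`-free `C₂ C₁ C_{L1} C_{L2}`) and the four letter rows on the DIFFERENCES `Z_{l+1} − Z_l` with constants `C′_s·θ^l` (`0 ≤ θ < 1`), all at one rate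
`δ > 0`, give `∃ Ccd θc δcd, 0 ≤ Ccd ∧ 0 ≤ θc ∧ θc < 1 ∧ 0 < δcd ∧ ∀ l, LocStencil₂ (cell_{l+1} − cell_l) (Ccd·θc^l) δcd`, `cell_l := 𝒜^Ĝ_l Z_l − 𝒜^K_l Z_l` (`θc = max θK θ`).
Route: `cell_l = 𝒜^K_l D_l` (leaf-06), `cell_{l+1} − cell_l = (𝒜^K_{l+1} − 𝒜^K_l) D_{l+1} + 𝒜^K_l (D_{l+1} − D_l)` (leaf-01's `lin4_sub`), MY `lin_cauchy` on `D_{l+1}` (FILE 1's uniform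
shape), leaf-01's `exists_lin4_rate` on `D_{l+1} − D_l` (§1's rate shape), `locStencil₂_add_rate`.  The rows are HYPOTHESES. -/
theorem cellDrift_rows_of_divergence_rows (hr : r ∈ box (d + 1) Lc) (c : ℝ) (Z : ℕ → Tab d) {CK δK cK θK : ℝ}
    (hK : ∀ j : ℕ, Decays (unitK (sfStep Lc j) (smStep d Lc j) (KInvStep (d := d) Lc j)) CK δK) (hδK : 0 < δK)
    (hKc : ∀ k j : ℕ, Decays (unitK (sfStep Lc (k + j)) (smStep d Lc (k + j)) (KInvStep (d := d) Lc (k + j))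
      - unitK (sfStep Lc k) (smStep d Lc k) (KInvStep (d := d) Lc k)) (cK * θK ^ k) δK) (hθK0 : 0 ≤ θK) (hθK1 : θK < 1)
    {C₂ C₁ CL₁ CL₂ C₂' C₁' CL₁' CL₂' θ δ : ℝ} (hδ : 0 < δ) (hθ0 : 0 ≤ θ) (hθ1 : θ < 1)
    (hZ : ∀ l, ∃ CZ δZ : ℝ, 0 < δZ ∧ LocStencil₂ (Z l) CZ δZ)
    (h₂ : ∀ l, LocStencil₂ (fun (κ : Fin (d + 1)) (u : Fin (d + 1) → ℤ) (_ : Fin (d + 1)) (p : Fin (d + 1) → ℤ) =>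
      divV (fun κ₁ u₁ => Z l κ u κ₁ u₁) p) C₂ δ)
    (h₁ : ∀ l, LocStencil₂ (fun (_ : Fin (d + 1)) (p : Fin (d + 1) → ℤ) (κ' : Fin (d + 1)) (u' : Fin (d + 1) → ℤ) =>
      divV (fun κ₁ u₁ => Z l κ₁ u₁ κ' u') p) C₁ δ)
    (hL₁ : ∀ l, LocStencil₂ (fun κ u κ' u' => fun (p z : Fin (d + 1) → ℤ) (_ : Fib d) (b : Fib d) =>
      ∑ β : Fin (d + 1), (Z l κ u κ' u' p z (Sum.inl β) b - Z l κ u κ' u' (p - unitVec β) z (Sum.inl β) b)) CL₁ δ)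
    (hL₂ : ∀ l, LocStencil₂ (fun κ u κ' u' => fun (x p : Fin (d + 1) → ℤ) (a : Fib d) (_ : Fib d) =>
      ∑ β : Fin (d + 1), (Z l κ u κ' u' x p a (Sum.inl β) - Z l κ u κ' u' x (p - unitVec β) a (Sum.inl β))) CL₂ δ)
    (h₂' : ∀ l, LocStencil₂ (fun (κ : Fin (d + 1)) (u : Fin (d + 1) → ℤ) (_ : Fin (d + 1)) (p : Fin (d + 1) → ℤ) =>
      divV (fun κ₁ u₁ => (Z (l + 1) - Z l) κ u κ₁ u₁) p) (C₂' * θ ^ l) δ)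
    (h₁' : ∀ l, LocStencil₂ (fun (_ : Fin (d + 1)) (p : Fin (d + 1) → ℤ) (κ' : Fin (d + 1)) (u' : Fin (d + 1) → ℤ) =>
      divV (fun κ₁ u₁ => (Z (l + 1) - Z l) κ₁ u₁ κ' u') p) (C₁' * θ ^ l) δ)
    (hL₁' : ∀ l, LocStencil₂ (fun κ u κ' u' => fun (p z : Fin (d + 1) → ℤ) (_ : Fib d) (b : Fib d) =>
      ∑ β : Fin (d + 1), ((Z (l + 1) - Z l) κ u κ' u' p z (Sum.inl β) b - (Z (l + 1) - Z l) κ u κ' u' (p - unitVec β) z (Sum.inl β) b)) (CL₁' * θ ^ l) δ)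
    (hL₂' : ∀ l, LocStencil₂ (fun κ u κ' u' => fun (x p : Fin (d + 1) → ℤ) (a : Fib d) (_ : Fib d) =>
      ∑ β : Fin (d + 1), ((Z (l + 1) - Z l) κ u κ' u' x p a (Sum.inl β) - (Z (l + 1) - Z l) κ u κ' u' x (p - unitVec β) a (Sum.inl β))) (CL₂' * θ ^ l) δ) :
    ∃ Ccd θc δcd : ℝ, 0 ≤ Ccd ∧ 0 ≤ θc ∧ θc < 1 ∧ 0 < δcd ∧ ∀ l, LocStencil₂
      ((lin4 c (unitK (sfStep Lc (l + 1)) (smStep d Lc (l + 1)) (coDressKBmAt (toSite r) Lc (KInvStep (d := d) Lc (l + 1)))) Lc (Z (l + 1))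
          - lin4 c (unitK (sfStep Lc (l + 1)) (smStep d Lc (l + 1)) (KInvStep (d := d) Lc (l + 1))) Lc (Z (l + 1)))
        - (lin4 c (unitK (sfStep Lc l) (smStep d Lc l) (coDressKBmAt (toSite r) Lc (KInvStep (d := d) Lc l))) Lc (Z l)
          - lin4 c (unitK (sfStep Lc l) (smStep d Lc l) (KInvStep (d := d) Lc l)) Lc (Z l)))
      (Ccd * θc ^ l) δcd := by
  have hLc : 1 ≤ Lc := one_le_of_neZero Lc
  have hCK : 0 ≤ CK := (hK 0).nonneg (Sum.inl 0)
  -- the defects `D_l := 𝔇 Z_l − Z_l`, uniformly shaped (FILE 1) and with rate-shaped differences (§1)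
  set CD : ℝ := 2 * ((d : ℝ) + 1) * Lc * ((((2 * Lc + 1) ^ (d + 1) : ℕ) : ℝ) * (Real.exp (δ * (((d : ℝ) + 1) * Lc)) * C₂))
        + 2 * ((d : ℝ) + 1) * Lc * ((((2 * Lc + 1) ^ (d + 1) : ℕ) : ℝ) * (Real.exp (3 * δ * (((d : ℝ) + 1) * Lc)) * (cKb d Lc δ * C₁)))
        + 2 * ((d : ℝ) + 1) * Lc * ((((2 * Lc + 1) ^ (d + 1) : ℕ) : ℝ)
            * (Real.exp (δ * (((d : ℝ) + 1) * Lc)) * (cWb d Lc * Real.exp (3 * δ * (((d : ℝ) + 1) * Lc)) * (cKb d Lc δ * CL₁))))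
        + 2 * ((d : ℝ) + 1) * Lc * ((((2 * Lc + 1) ^ (d + 1) : ℕ) : ℝ)
            * (Real.exp (δ * (((d : ℝ) + 1) * Lc)) * (cKb d Lc δ * (cWb d Lc * Real.exp (3 * δ * (((d : ℝ) + 1) * Lc)) * (cKb d Lc δ * CL₂))))) with hCD
  set CD' : ℝ := 2 * ((d : ℝ) + 1) * Lc * ((((2 * Lc + 1) ^ (d + 1) : ℕ) : ℝ) * (Real.exp (δ * (((d : ℝ) + 1) * Lc)) * C₂'))
        + 2 * ((d : ℝ) + 1) * Lc * ((((2 * Lc + 1) ^ (d + 1) : ℕ) : ℝ) * (Real.exp (3 * δ * (((d : ℝ) + 1) * Lc)) * (cKb d Lc δ * C₁')))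
        + 2 * ((d : ℝ) + 1) * Lc * ((((2 * Lc + 1) ^ (d + 1) : ℕ) : ℝ)
            * (Real.exp (δ * (((d : ℝ) + 1) * Lc)) * (cWb d Lc * Real.exp (3 * δ * (((d : ℝ) + 1) * Lc)) * (cKb d Lc δ * CL₁'))))
        + 2 * ((d : ℝ) + 1) * Lc * ((((2 * Lc + 1) ^ (d + 1) : ℕ) : ℝ)
            * (Real.exp (δ * (((d : ℝ) + 1) * Lc)) * (cKb d Lc δ * (cWb d Lc * Real.exp (3 * δ * (((d : ℝ) + 1) * Lc)) * (cKb d Lc δ * CL₂'))))) with hCD'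
  have hD : ∀ l, LocStencil₂ ((fun κ u κ' u' => dressKBmAt (toSite r) Lc (coProjBmAtK (toSite r) Lc (fun κ₁ u₁ => coProjBmAtK (toSite r) Lc (Z l κ₁ u₁) κ' u') κ u)) - Z l)
      CD δ := fun l => by
    rw [hCD]; exact locStencil₂_tableDress_sub_self_of_divergences hLc hr (Z l) hδ.le (h₂ l) (h₁ l) (hL₁ l) (hL₂ l)
  have hDr : ∀ l, LocStencil₂ (((fun κ u κ' u' => dressKBmAt (toSite r) Lc (coProjBmAtK (toSite r) Lc (fun κ₁ u₁ => coProjBmAtK (toSite r) Lc (Z (l + 1) κ₁ u₁) κ' u') κ u))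
          - Z (l + 1))
        - ((fun κ u κ' u' => dressKBmAt (toSite r) Lc (coProjBmAtK (toSite r) Lc (fun κ₁ u₁ => coProjBmAtK (toSite r) Lc (Z l κ₁ u₁) κ' u') κ u)) - Z l))
      (CD' * θ ^ l) δ := fun l => by
    have h := locStencil₂_tableDress_defect_sub_of_divergences hLc hr (Z (l + 1)) (Z l) hδ.le (h₂' l) (h₁' l) (hL₁' l) (hL₂' l)
    rw [defectConst_mul] at h
    rw [hCD']; exact h
  have hCD0 : 0 ≤ CD := (hD 0).nonneg
  have hCD'0 : 0 ≤ CD' := by have h := (hDr 0).nonneg; simpa using h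
  -- the cell identity, level by level (leaf-06), and the split of the difference (leaf-01's `lin4_sub`)
  have hcell : ∀ l, lin4 c (unitK (sfStep Lc l) (smStep d Lc l) (coDressKBmAt (toSite r) Lc (KInvStep (d := d) Lc l))) Lc (Z l)
        - lin4 c (unitK (sfStep Lc l) (smStep d Lc l) (KInvStep (d := d) Lc l)) Lc (Z l)
      = lin4 c (unitK (sfStep Lc l) (smStep d Lc l) (KInvStep (d := d) Lc l)) Lc
          ((fun κ u κ' u' => dressKBmAt (toSite r) Lc (coProjBmAtK (toSite r) Lc (fun κ₁ u₁ => coProjBmAtK (toSite r) Lc (Z l κ₁ u₁) κ' u') κ u)) - Z l) := by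
    intro l
    obtain ⟨CZ, δZ, hδZ, hZl⟩ := hZ l
    exact lin4_comb_coDressKBmAt_sub hr l hZl hδZ c
  have e : ∀ l, (lin4 c (unitK (sfStep Lc (l + 1)) (smStep d Lc (l + 1)) (coDressKBmAt (toSite r) Lc (KInvStep (d := d) Lc (l + 1)))) Lc (Z (l + 1))
          - lin4 c (unitK (sfStep Lc (l + 1)) (smStep d Lc (l + 1)) (KInvStep (d := d) Lc (l + 1))) Lc (Z (l + 1)))
        - (lin4 c (unitK (sfStep Lc l) (smStep d Lc l) (coDressKBmAt (toSite r) Lc (KInvStep (d := d) Lc l))) Lc (Z l)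
          - lin4 c (unitK (sfStep Lc l) (smStep d Lc l) (KInvStep (d := d) Lc l)) Lc (Z l))
      = (lin4 c (unitK (sfStep Lc (l + 1)) (smStep d Lc (l + 1)) (KInvStep (d := d) Lc (l + 1))) Lc
            ((fun κ u κ' u' => dressKBmAt (toSite r) Lc (coProjBmAtK (toSite r) Lc (fun κ₁ u₁ => coProjBmAtK (toSite r) Lc (Z (l + 1) κ₁ u₁) κ' u') κ u)) - Z (l + 1))
          - lin4 c (unitK (sfStep Lc l) (smStep d Lc l) (KInvStep (d := d) Lc l)) Lc
            ((fun κ u κ' u' => dressKBmAt (toSite r) Lc (coProjBmAtK (toSite r) Lc (fun κ₁ u₁ => coProjBmAtK (toSite r) Lc (Z (l + 1) κ₁ u₁) κ' u') κ u)) - Z (l + 1)))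
        + lin4 c (unitK (sfStep Lc l) (smStep d Lc l) (KInvStep (d := d) Lc l)) Lc
            (((fun κ u κ' u' => dressKBmAt (toSite r) Lc (coProjBmAtK (toSite r) Lc (fun κ₁ u₁ => coProjBmAtK (toSite r) Lc (Z (l + 1) κ₁ u₁) κ' u') κ u)) - Z (l + 1))
              - ((fun κ u κ' u' => dressKBmAt (toSite r) Lc (coProjBmAtK (toSite r) Lc (fun κ₁ u₁ => coProjBmAtK (toSite r) Lc (Z l κ₁ u₁) κ' u') κ u)) - Z l)) := by
    intro l
    rw [hcell (l + 1), hcell l, lin4_sub (hK l) hδK c Lc (fun κ u κ' u' x z a b => sup_of_locStencil₂ hδ.le (hD (l + 1)) κ u κ' u' x z a b)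
      (fun κ u κ' u' x z a b => sup_of_locStencil₂ hδ.le (hD l) κ u κ' u' x z a b)]
    abel
  -- term 1: the transport DIFFERENCE on the next defect (MY `lin_cauchy`)
  obtain ⟨m₀, hm₀_def⟩ : ∃ m₀ : ℝ, m₀ = min δK δ := ⟨_, rfl⟩
  have hm₀ : 0 < m₀ := by rw [hm₀_def]; exact lt_min hδK hδ
  have hK1 : ∀ j, Decays (unitK (sfStep Lc j) (smStep d Lc j) (KInvStep (d := d) Lc j)) CK m₀ :=
    fun j => decays_mono (hK j) hCK le_rfl (by rw [hm₀_def]; exact min_le_left _ _)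
  have hKc1 : ∀ k j, Decays ((unitK (sfStep Lc (k + j)) (smStep d Lc (k + j)) (KInvStep (d := d) Lc (k + j)))
      - (unitK (sfStep Lc k) (smStep d Lc k) (KInvStep (d := d) Lc k))) (cK * θK ^ k) m₀ :=
    fun k j => decays_mono (hKc k j) (by have h := (hKc k j).nonneg (Sum.inl 0); exact h) le_rfl (by rw [hm₀_def]; exact min_le_left _ _)
  have hD₀ : ∀ l, LocStencil₂ ((fun κ u κ' u' => dressKBmAt (toSite r) Lc (coProjBmAtK (toSite r) Lc (fun κ₁ u₁ => coProjBmAtK (toSite r) Lc (Z l κ₁ u₁) κ' u') κ u)) - Z l)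
      CD m₀ := fun l => (hD l).mono (by rw [hm₀_def]; exact min_le_right _ _)
  obtain ⟨L₁, hL₁_def⟩ : ∃ L₁ : ℝ, L₁ = |c| * lSand d CK (cBi d CK CD m₀) cK (lBi d CK CD cK 0 m₀) (m₀ / 32) := ⟨_, rfl⟩
  have h1 : ∀ l : ℕ, LocStencil₂ (lin4 c (unitK (sfStep Lc (l + 1)) (smStep d Lc (l + 1)) (KInvStep (d := d) Lc (l + 1))) Lc
            ((fun κ u κ' u' => dressKBmAt (toSite r) Lc (coProjBmAtK (toSite r) Lc (fun κ₁ u₁ => coProjBmAtK (toSite r) Lc (Z (l + 1) κ₁ u₁) κ' u') κ u)) - Z (l + 1))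
          - lin4 c (unitK (sfStep Lc l) (smStep d Lc l) (KInvStep (d := d) Lc l)) Lc
            ((fun κ u κ' u' => dressKBmAt (toSite r) Lc (coProjBmAtK (toSite r) Lc (fun κ₁ u₁ => coProjBmAtK (toSite r) Lc (Z (l + 1) κ₁ u₁) κ' u') κ u)) - Z (l + 1)))
      (L₁ * θK ^ l) (m₀ / 128) := fun l => by
    rw [hL₁_def]
    exact lin_cauchy (Lc := Lc) (K := fun j => (unitK (sfStep Lc j) (smStep d Lc j) (KInvStep (d := d) Lc j))) hLc hm₀ hK1 hKc1 (hD₀ (l + 1)) c l 1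
  have hL₁ : 0 ≤ L₁ := by have h := (h1 0).nonneg; simpa using h
  -- term 2: one undressed step of the defect's rate row (leaf-01's `exists_lin4_rate`)
  obtain ⟨L₂, hL₂, h2⟩ := exists_lin4_rate hLc c
    (fun l => ((fun κ u κ' u' => dressKBmAt (toSite r) Lc (coProjBmAtK (toSite r) Lc (fun κ₁ u₁ => coProjBmAtK (toSite r) Lc (Z (l + 1) κ₁ u₁) κ' u') κ u)) - Z (l + 1))
      - ((fun κ u κ' u' => dressKBmAt (toSite r) Lc (coProjBmAtK (toSite r) Lc (fun κ₁ u₁ => coProjBmAtK (toSite r) Lc (Z l κ₁ u₁) κ' u') κ u)) - Z l)) hK hδK hDr hδ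
  refine ⟨L₁ + L₂, max θK θ, min (m₀ / 128) (min δK δ / 128), add_nonneg hL₁ hL₂, hθK0.trans (le_max_left _ _), max_lt hθK1 hθ1,
    lt_min (by positivity) (by positivity), fun l => ?_⟩
  rw [e l]
  exact locStencil₂_add_rate (h1 l) (h2 l) hL₁ hL₂ hθK0 hθ0

end Generic

/-! ## §3 `d = 3`: the `hcelld` row of the OWNER's `T2DriftEvenEndRows` from the letter rows and the letter-drift rows on the `ε`-member -/

section Three

variable {Lc : ℕ} [NeZero Lc] {r : Fin (3 + 1) → ℕ}

/-- NOT IN PRINT; OUR BOOKKEEPING.  **THE CELLS' ONE-STEP DRIFT `hcelld` OF THE (α-0) DRIFT END FROM THE FOUR LETTER ROWS AND THE FOUR LETTER-DRIFT ROWS ON THE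
`ε`-MEMBER** (`d = 3`, `2 ≤ Lc`, in-block root `r`, any pins `cE cVH cΛ cE₂ cB Tc`, any positive-rate `LocStencil₂` border `vh₂S`, `|ε| ≤ 1`): write
`y_l := ½ • (T♮̃_l + ε • P T♮̃_l)` (the END's EXACT spelling) and `cell_l := 𝒜^Ĝ_l y_l − 𝒜^K_l y_l` (the `hcell` spelling of `T2ShapeEvenEndRows`).  If, for every `l`, the
four single-divergence letter rows of `y_l` hold with `l`-FREE constants and those of the DIFFERENCE `y_{l+1} − y_l` with constants `C′_s·θ^l` (`0 ≤ θ < 1`), all at one rate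
`δ > 0`, then `∃ Ccd θc δcd, 0 ≤ Ccd ∧ 0 ≤ θc ∧ θc < 1 ∧ 0 < δcd ∧ ∀ l, LocStencil₂ (cell_{l+1} − cell_l) (Ccd·θc^l) δcd` — the OWNER gan24-p1 g34's displayed row (α-END-b′)
`hcelld`.  §2 with road P1's K-slot (`convCKWall_holds`: uniform decay AND the Cauchy row) and the member's shape (`shape_member` ⨾ `locStencil₂_halfTable`) BY NAME.
The eight rows are HYPOTHESES: the slot rows ∕ slot-drift rows are (b1) ∘ F4 ∘ row (ii) data (and their differences), the leg rows ∕ leg-drift rows are (Q-L); nothing of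
them is proved here. -/
theorem hcelld_of_divergence_rows (hLc : 2 ≤ Lc) (hr : r ∈ box (3 + 1) Lc) (cE cVH cΛ cE₂ cB : ℝ) (Tc : Fin 4 → Fin 4 → Fin 4 → Fin 4 → ℝ)
    {vh₂S : Fin (3 + 1) → (Fin (3 + 1) → ℤ) → Fin (3 + 1) → (Fin (3 + 1) → ℤ) → MKer (3 + 1) (Fib 3)}
    {CB δB : ℝ} (hB : LocStencil₂ vh₂S CB δB) (hδB : 0 < δB) (ε : ℝ) (hε : |ε| ≤ 1) {C₂ C₁ CL₁ CL₂ C₂' C₁' CL₁' CL₂' θ δ : ℝ} (hδ : 0 < δ)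
    (hθ0 : 0 ≤ θ) (hθ1 : θ < 1)
    (h₂ : ∀ l, LocStencil₂ (fun (κ : Fin (3 + 1)) (u : Fin (3 + 1) → ℤ) (_ : Fin (3 + 1)) (p : Fin (3 + 1) → ℤ) =>
      divV (fun κ₁ u₁ => (((1 : ℝ) / 2) • (unitS₂ (sfStep Lc l) (smStep 3 Lc l) (T2RecAt 3 Lc (toSite r) cE cVH cΛ cE₂ cB Tc vh₂S (mixFFAt (toSite r) Lc) l)
        + ε • fun κ u κ' u' => sgnK (trK ((unitS₂ (sfStep Lc l) (smStep 3 Lc l) (T2RecAt 3 Lc (toSite r) cE cVH cΛ cE₂ cB Tc vh₂S (mixFFAt (toSite r) Lc) l))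
          κ u κ' u')))) κ u κ₁ u₁) p) C₂ δ)
    (h₁ : ∀ l, LocStencil₂ (fun (_ : Fin (3 + 1)) (p : Fin (3 + 1) → ℤ) (κ' : Fin (3 + 1)) (u' : Fin (3 + 1) → ℤ) =>
      divV (fun κ₁ u₁ => (((1 : ℝ) / 2) • (unitS₂ (sfStep Lc l) (smStep 3 Lc l) (T2RecAt 3 Lc (toSite r) cE cVH cΛ cE₂ cB Tc vh₂S (mixFFAt (toSite r) Lc) l)
        + ε • fun κ u κ' u' => sgnK (trK ((unitS₂ (sfStep Lc l) (smStep 3 Lc l) (T2RecAt 3 Lc (toSite r) cE cVH cΛ cE₂ cB Tc vh₂S (mixFFAt (toSite r) Lc) l))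
          κ u κ' u')))) κ₁ u₁ κ' u') p) C₁ δ)
    (hL₁ : ∀ l, LocStencil₂ (fun κ u κ' u' => fun (p z : Fin (3 + 1) → ℤ) (_ : Fib 3) (b : Fib 3) =>
      ∑ β : Fin (3 + 1), ((((1 : ℝ) / 2) • (unitS₂ (sfStep Lc l) (smStep 3 Lc l) (T2RecAt 3 Lc (toSite r) cE cVH cΛ cE₂ cB Tc vh₂S (mixFFAt (toSite r) Lc) l)
        + ε • fun κ u κ' u' => sgnK (trK ((unitS₂ (sfStep Lc l) (smStep 3 Lc l) (T2RecAt 3 Lc (toSite r) cE cVH cΛ cE₂ cB Tc vh₂S (mixFFAt (toSite r) Lc) l))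
          κ u κ' u')))) κ u κ' u' p z (Sum.inl β) b
        - (((1 : ℝ) / 2) • (unitS₂ (sfStep Lc l) (smStep 3 Lc l) (T2RecAt 3 Lc (toSite r) cE cVH cΛ cE₂ cB Tc vh₂S (mixFFAt (toSite r) Lc) l)
        + ε • fun κ u κ' u' => sgnK (trK ((unitS₂ (sfStep Lc l) (smStep 3 Lc l) (T2RecAt 3 Lc (toSite r) cE cVH cΛ cE₂ cB Tc vh₂S (mixFFAt (toSite r) Lc) l))
          κ u κ' u')))) κ u κ' u' (p - unitVec β) z (Sum.inl β) b)) CL₁ δ)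
    (hL₂ : ∀ l, LocStencil₂ (fun κ u κ' u' => fun (x p : Fin (3 + 1) → ℤ) (a : Fib 3) (_ : Fib 3) =>
      ∑ β : Fin (3 + 1), ((((1 : ℝ) / 2) • (unitS₂ (sfStep Lc l) (smStep 3 Lc l) (T2RecAt 3 Lc (toSite r) cE cVH cΛ cE₂ cB Tc vh₂S (mixFFAt (toSite r) Lc) l)
        + ε • fun κ u κ' u' => sgnK (trK ((unitS₂ (sfStep Lc l) (smStep 3 Lc l) (T2RecAt 3 Lc (toSite r) cE cVH cΛ cE₂ cB Tc vh₂S (mixFFAt (toSite r) Lc) l))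
          κ u κ' u')))) κ u κ' u' x p a (Sum.inl β)
        - (((1 : ℝ) / 2) • (unitS₂ (sfStep Lc l) (smStep 3 Lc l) (T2RecAt 3 Lc (toSite r) cE cVH cΛ cE₂ cB Tc vh₂S (mixFFAt (toSite r) Lc) l)
        + ε • fun κ u κ' u' => sgnK (trK ((unitS₂ (sfStep Lc l) (smStep 3 Lc l) (T2RecAt 3 Lc (toSite r) cE cVH cΛ cE₂ cB Tc vh₂S (mixFFAt (toSite r) Lc) l))
          κ u κ' u')))) κ u κ' u' x (p - unitVec β) a (Sum.inl β))) CL₂ δ)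
    (h₂' : ∀ l, LocStencil₂ (fun (κ : Fin (3 + 1)) (u : Fin (3 + 1) → ℤ) (_ : Fin (3 + 1)) (p : Fin (3 + 1) → ℤ) =>
      divV (fun κ₁ u₁ => ((((1 : ℝ) / 2) • (unitS₂ (sfStep Lc (l + 1)) (smStep 3 Lc (l + 1)) (T2RecAt 3 Lc (toSite r) cE cVH cΛ cE₂ cB Tc vh₂S (mixFFAt (toSite r) Lc) (l + 1))
        + ε • fun κ u κ' u' => sgnK (trK ((unitS₂ (sfStep Lc (l + 1)) (smStep 3 Lc (l + 1)) (T2RecAt 3 Lc (toSite r) cE cVH cΛ cE₂ cB Tc vh₂S (mixFFAt (toSite r) Lc) (l + 1)))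
          κ u κ' u'))))
        - (((1 : ℝ) / 2) • (unitS₂ (sfStep Lc l) (smStep 3 Lc l) (T2RecAt 3 Lc (toSite r) cE cVH cΛ cE₂ cB Tc vh₂S (mixFFAt (toSite r) Lc) l)
        + ε • fun κ u κ' u' => sgnK (trK ((unitS₂ (sfStep Lc l) (smStep 3 Lc l) (T2RecAt 3 Lc (toSite r) cE cVH cΛ cE₂ cB Tc vh₂S (mixFFAt (toSite r) Lc) l))
          κ u κ' u'))))) κ u κ₁ u₁) p) (C₂' * θ ^ l) δ)
    (h₁' : ∀ l, LocStencil₂ (fun (_ : Fin (3 + 1)) (p : Fin (3 + 1) → ℤ) (κ' : Fin (3 + 1)) (u' : Fin (3 + 1) → ℤ) =>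
      divV (fun κ₁ u₁ => ((((1 : ℝ) / 2) • (unitS₂ (sfStep Lc (l + 1)) (smStep 3 Lc (l + 1)) (T2RecAt 3 Lc (toSite r) cE cVH cΛ cE₂ cB Tc vh₂S (mixFFAt (toSite r) Lc) (l + 1))
        + ε • fun κ u κ' u' => sgnK (trK ((unitS₂ (sfStep Lc (l + 1)) (smStep 3 Lc (l + 1)) (T2RecAt 3 Lc (toSite r) cE cVH cΛ cE₂ cB Tc vh₂S (mixFFAt (toSite r) Lc) (l + 1)))
          κ u κ' u'))))
        - (((1 : ℝ) / 2) • (unitS₂ (sfStep Lc l) (smStep 3 Lc l) (T2RecAt 3 Lc (toSite r) cE cVH cΛ cE₂ cB Tc vh₂S (mixFFAt (toSite r) Lc) l)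
        + ε • fun κ u κ' u' => sgnK (trK ((unitS₂ (sfStep Lc l) (smStep 3 Lc l) (T2RecAt 3 Lc (toSite r) cE cVH cΛ cE₂ cB Tc vh₂S (mixFFAt (toSite r) Lc) l))
          κ u κ' u'))))) κ₁ u₁ κ' u') p) (C₁' * θ ^ l) δ)
    (hL₁' : ∀ l, LocStencil₂ (fun κ u κ' u' => fun (p z : Fin (3 + 1) → ℤ) (_ : Fib 3) (b : Fib 3) =>
      ∑ β : Fin (3 + 1), (((((1 : ℝ) / 2) • (unitS₂ (sfStep Lc (l + 1)) (smStep 3 Lc (l + 1)) (T2RecAt 3 Lc (toSite r) cE cVH cΛ cE₂ cB Tc vh₂S (mixFFAt (toSite r) Lc) (l + 1))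
        + ε • fun κ u κ' u' => sgnK (trK ((unitS₂ (sfStep Lc (l + 1)) (smStep 3 Lc (l + 1)) (T2RecAt 3 Lc (toSite r) cE cVH cΛ cE₂ cB Tc vh₂S (mixFFAt (toSite r) Lc) (l + 1)))
          κ u κ' u'))))
        - (((1 : ℝ) / 2) • (unitS₂ (sfStep Lc l) (smStep 3 Lc l) (T2RecAt 3 Lc (toSite r) cE cVH cΛ cE₂ cB Tc vh₂S (mixFFAt (toSite r) Lc) l)
        + ε • fun κ u κ' u' => sgnK (trK ((unitS₂ (sfStep Lc l) (smStep 3 Lc l) (T2RecAt 3 Lc (toSite r) cE cVH cΛ cE₂ cB Tc vh₂S (mixFFAt (toSite r) Lc) l))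
          κ u κ' u'))))) κ u κ' u' p z (Sum.inl β) b
        - ((((1 : ℝ) / 2) • (unitS₂ (sfStep Lc (l + 1)) (smStep 3 Lc (l + 1)) (T2RecAt 3 Lc (toSite r) cE cVH cΛ cE₂ cB Tc vh₂S (mixFFAt (toSite r) Lc) (l + 1))
        + ε • fun κ u κ' u' => sgnK (trK ((unitS₂ (sfStep Lc (l + 1)) (smStep 3 Lc (l + 1)) (T2RecAt 3 Lc (toSite r) cE cVH cΛ cE₂ cB Tc vh₂S (mixFFAt (toSite r) Lc) (l + 1)))
          κ u κ' u'))))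
        - (((1 : ℝ) / 2) • (unitS₂ (sfStep Lc l) (smStep 3 Lc l) (T2RecAt 3 Lc (toSite r) cE cVH cΛ cE₂ cB Tc vh₂S (mixFFAt (toSite r) Lc) l)
        + ε • fun κ u κ' u' => sgnK (trK ((unitS₂ (sfStep Lc l) (smStep 3 Lc l) (T2RecAt 3 Lc (toSite r) cE cVH cΛ cE₂ cB Tc vh₂S (mixFFAt (toSite r) Lc) l))
          κ u κ' u'))))) κ u κ' u' (p - unitVec β) z (Sum.inl β) b)) (CL₁' * θ ^ l) δ)
    (hL₂' : ∀ l, LocStencil₂ (fun κ u κ' u' => fun (x p : Fin (3 + 1) → ℤ) (a : Fib 3) (_ : Fib 3) =>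
      ∑ β : Fin (3 + 1), (((((1 : ℝ) / 2) • (unitS₂ (sfStep Lc (l + 1)) (smStep 3 Lc (l + 1)) (T2RecAt 3 Lc (toSite r) cE cVH cΛ cE₂ cB Tc vh₂S (mixFFAt (toSite r) Lc) (l + 1))
        + ε • fun κ u κ' u' => sgnK (trK ((unitS₂ (sfStep Lc (l + 1)) (smStep 3 Lc (l + 1)) (T2RecAt 3 Lc (toSite r) cE cVH cΛ cE₂ cB Tc vh₂S (mixFFAt (toSite r) Lc) (l + 1)))
          κ u κ' u'))))
        - (((1 : ℝ) / 2) • (unitS₂ (sfStep Lc l) (smStep 3 Lc l) (T2RecAt 3 Lc (toSite r) cE cVH cΛ cE₂ cB Tc vh₂S (mixFFAt (toSite r) Lc) l)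
        + ε • fun κ u κ' u' => sgnK (trK ((unitS₂ (sfStep Lc l) (smStep 3 Lc l) (T2RecAt 3 Lc (toSite r) cE cVH cΛ cE₂ cB Tc vh₂S (mixFFAt (toSite r) Lc) l))
          κ u κ' u'))))) κ u κ' u' x p a (Sum.inl β)
        - ((((1 : ℝ) / 2) • (unitS₂ (sfStep Lc (l + 1)) (smStep 3 Lc (l + 1)) (T2RecAt 3 Lc (toSite r) cE cVH cΛ cE₂ cB Tc vh₂S (mixFFAt (toSite r) Lc) (l + 1))
        + ε • fun κ u κ' u' => sgnK (trK ((unitS₂ (sfStep Lc (l + 1)) (smStep 3 Lc (l + 1)) (T2RecAt 3 Lc (toSite r) cE cVH cΛ cE₂ cB Tc vh₂S (mixFFAt (toSite r) Lc) (l + 1)))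
          κ u κ' u'))))
        - (((1 : ℝ) / 2) • (unitS₂ (sfStep Lc l) (smStep 3 Lc l) (T2RecAt 3 Lc (toSite r) cE cVH cΛ cE₂ cB Tc vh₂S (mixFFAt (toSite r) Lc) l)
        + ε • fun κ u κ' u' => sgnK (trK ((unitS₂ (sfStep Lc l) (smStep 3 Lc l) (T2RecAt 3 Lc (toSite r) cE cVH cΛ cE₂ cB Tc vh₂S (mixFFAt (toSite r) Lc) l))
          κ u κ' u'))))) κ u κ' u' x (p - unitVec β) a (Sum.inl β))) (CL₂' * θ ^ l) δ) :
    ∃ Ccd θc δcd : ℝ, 0 ≤ Ccd ∧ 0 ≤ θc ∧ θc < 1 ∧ 0 < δcd ∧ ∀ l, LocStencil₂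
      ((lin4 (cE₂ * (Lc : ℝ) ^ (2 * (3 + 1))) (unitK (sfStep Lc (l + 1)) (smStep 3 Lc (l + 1)) (coDressKBmAt (toSite r) Lc (KInvStep (d := 3) Lc (l + 1)))) Lc
          (((1 : ℝ) / 2) • (unitS₂ (sfStep Lc (l + 1)) (smStep 3 Lc (l + 1)) (T2RecAt 3 Lc (toSite r) cE cVH cΛ cE₂ cB Tc vh₂S (mixFFAt (toSite r) Lc) (l + 1))
        + ε • fun κ u κ' u' => sgnK (trK ((unitS₂ (sfStep Lc (l + 1)) (smStep 3 Lc (l + 1)) (T2RecAt 3 Lc (toSite r) cE cVH cΛ cE₂ cB Tc vh₂S (mixFFAt (toSite r) Lc) (l + 1)))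
          κ u κ' u'))))
        - lin4 (cE₂ * (Lc : ℝ) ^ (2 * (3 + 1))) (unitK (sfStep Lc (l + 1)) (smStep 3 Lc (l + 1)) (KInvStep (d := 3) Lc (l + 1))) Lc
          (((1 : ℝ) / 2) • (unitS₂ (sfStep Lc (l + 1)) (smStep 3 Lc (l + 1)) (T2RecAt 3 Lc (toSite r) cE cVH cΛ cE₂ cB Tc vh₂S (mixFFAt (toSite r) Lc) (l + 1))
        + ε • fun κ u κ' u' => sgnK (trK ((unitS₂ (sfStep Lc (l + 1)) (smStep 3 Lc (l + 1)) (T2RecAt 3 Lc (toSite r) cE cVH cΛ cE₂ cB Tc vh₂S (mixFFAt (toSite r) Lc) (l + 1)))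
          κ u κ' u')))))
        - (lin4 (cE₂ * (Lc : ℝ) ^ (2 * (3 + 1))) (unitK (sfStep Lc l) (smStep 3 Lc l) (coDressKBmAt (toSite r) Lc (KInvStep (d := 3) Lc l))) Lc
          (((1 : ℝ) / 2) • (unitS₂ (sfStep Lc l) (smStep 3 Lc l) (T2RecAt 3 Lc (toSite r) cE cVH cΛ cE₂ cB Tc vh₂S (mixFFAt (toSite r) Lc) l)
        + ε • fun κ u κ' u' => sgnK (trK ((unitS₂ (sfStep Lc l) (smStep 3 Lc l) (T2RecAt 3 Lc (toSite r) cE cVH cΛ cE₂ cB Tc vh₂S (mixFFAt (toSite r) Lc) l))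
          κ u κ' u'))))
        - lin4 (cE₂ * (Lc : ℝ) ^ (2 * (3 + 1))) (unitK (sfStep Lc l) (smStep 3 Lc l) (KInvStep (d := 3) Lc l)) Lc
          (((1 : ℝ) / 2) • (unitS₂ (sfStep Lc l) (smStep 3 Lc l) (T2RecAt 3 Lc (toSite r) cE cVH cΛ cE₂ cB Tc vh₂S (mixFFAt (toSite r) Lc) l)
        + ε • fun κ u κ' u' => sgnK (trK ((unitS₂ (sfStep Lc l) (smStep 3 Lc l) (T2RecAt 3 Lc (toSite r) cE cVH cΛ cE₂ cB Tc vh₂S (mixFFAt (toSite r) Lc) l))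
          κ u κ' u'))))))
      (Ccd * θc ^ l) δcd := by
  obtain ⟨CK, δK, cK, θK, hδK, hθK0, hθK1, hK, hKall⟩ := convCKWall_holds (Lc := Lc) hLc
  have hLc1 : 1 ≤ Lc := le_trans (by norm_num) hLc
  have hZ : ∀ l, ∃ CZ δZ : ℝ, 0 < δZ ∧ LocStencil₂ (((1 : ℝ) / 2) • (unitS₂ (sfStep Lc l) (smStep 3 Lc l) (T2RecAt 3 Lc (toSite r) cE cVH cΛ cE₂ cB Tc vh₂S (mixFFAt (toSite r) Lc) l)
        + ε • fun κ u κ' u' => sgnK (trK ((unitS₂ (sfStep Lc l) (smStep 3 Lc l) (T2RecAt 3 Lc (toSite r) cE cVH cΛ cE₂ cB Tc vh₂S (mixFFAt (toSite r) Lc) l))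
          κ u κ' u')))) CZ δZ := by
    intro l
    obtain ⟨CT, δT, hδT, hT⟩ := shape_member (d := 3) hLc1 hr cE cVH cΛ cE₂ cB Tc ⟨CB, δB, hδB, hB⟩ l
    exact ⟨CT, δT, hδT, locStencil₂_halfTable hT hε⟩
  exact cellDrift_rows_of_divergence_rows (d := 3) hr (cE₂ * (Lc : ℝ) ^ (2 * (3 + 1)))
    (fun l => (((1 : ℝ) / 2) • (unitS₂ (sfStep Lc l) (smStep 3 Lc l) (T2RecAt 3 Lc (toSite r) cE cVH cΛ cE₂ cB Tc vh₂S (mixFFAt (toSite r) Lc) l)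
        + ε • fun κ u κ' u' => sgnK (trK ((unitS₂ (sfStep Lc l) (smStep 3 Lc l) (T2RecAt 3 Lc (toSite r) cE cVH cΛ cE₂ cB Tc vh₂S (mixFFAt (toSite r) Lc) l))
          κ u κ' u')))))
    hK hδK hKall hθK0 hθK1 hδ hθ0 hθ1 hZ h₂ h₁ hL₁ hL₂ h₂' h₁' hL₁' hL₂'

end Three

end Summit.QuantumFields.BalabanUV.Beta.GAN24.HalfMemberCellDriftOfDivergences

end
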